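import Mathlib

/-!
# Crux `SlicedKelvin.PlanarFluxAPriori` (stmt-NavierStokesRegularity-15600), line `registered`:
  Fubini over the plane foliation `(c, y) ↦ R (y₀, y₁, c)` (helper for `stub_heatKernelDomination`)

In the heat-kernel domination step of the skeleton `Cruxes/PlanarFluxAPriori/Lines/birth.lean` the
source of the 1-D heat inequality in the height `c` is a plane integral `∫_{R{x₂ = c}} s_ε⁺ dA`, and the
Duhamel bound against the kernel sup `(4πν(t−τ))^{-1/2}` turns `∫ dc ∫_{R{x₂=c}} s_ε⁺ dA` into the BULK
integral `∫_{ℝ³} s_ε⁺` that the stub's fold-creation functional carries. This file proves that identity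
for every Borel `g : ℝ³ → ℝ≥0∞` and every linear isometry `R` of `ℝ³`:

* `snoc_eq_vec3` — `Fin.snoc y c = ![y 0, y 1, c]`;
* `measurePreserving_foliationChart` — the chart `(c, y) ↦ R (y₀, y₁, c)`, `ℝ × ℝ² → ℝ³`, preserves
  Lebesgue measure (it is `R ∘ toLp ∘ (piFinSuccAbove _ (last 2))⁻¹ ∘ (id × ofLp)`, a composition of
  measure-preserving maps: Mathlib `LinearIsometryEquiv.measurePreserving`, `PiLp.volume_preserving_toLp`,
  `volume_preserving_piFinSuccAbove`, `PiLp.volume_preserving_ofLp`);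
* `lintegral_lintegral_foliation` — `∫⁻ c, ∫⁻ y, g (R (y₀, y₁, c)) = ∫⁻ x, g x` (Tonelli,
  `lintegral_prod`, along the chart).

Mathlib only; no fluid mechanics enters.
-/

noncomputable section

-- Problem = summit for this single-conjunct summit: the duplicate namespace component is deliberate.
set_option linter.dupNamespace false

namespace Summit.NavierStokesRegularity.NavierStokesRegularity.Theorems.SlicedKelvinPlanarFluxAPriori

open MeasureTheory
open scoped ENNReal

/-- `Fin.snoc y c = ![y 0, y 1, c]`: appending the height as the last coordinate. -/
theorem snoc_eq_vec3 (c : ℝ) (y : Fin 2 → ℝ) :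
    (Fin.snoc y c : Fin 3 → ℝ) = ![y 0, y 1, c] := by
  funext i
  fin_cases i <;> rfl

/-- **The foliation chart preserves Lebesgue measure.** For a linear isometry `R` of `ℝ³`, the map
`(c, y) ↦ R (y₀, y₁, c)` from `ℝ × ℝ²` (product Lebesgue measure) onto `ℝ³` is measure preserving. -/
theorem measurePreserving_foliationChart
    (R : EuclideanSpace ℝ (Fin 3) ≃ₗᵢ[ℝ] EuclideanSpace ℝ (Fin 3)) :
    MeasurePreserving (fun p : ℝ × EuclideanSpace ℝ (Fin 2) => R (WithLp.toLp 2 ![p.2 0, p.2 1, p.1]))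
      ((volume : Measure ℝ).prod (volume : Measure (EuclideanSpace ℝ (Fin 2))))
      (volume : Measure (EuclideanSpace ℝ (Fin 3))) := by
  have h1 : MeasurePreserving (Prod.map (id : ℝ → ℝ)
      (WithLp.ofLp : EuclideanSpace ℝ (Fin 2) → (Fin 2 → ℝ)))
      ((volume : Measure ℝ).prod (volume : Measure (EuclideanSpace ℝ (Fin 2))))
      ((volume : Measure ℝ).prod (volume : Measure (Fin 2 → ℝ))) :=
    (MeasurePreserving.id volume).prod (PiLp.volume_preserving_ofLp (Fin 2))
  have h2 : MeasurePreserving (MeasurableEquiv.piFinSuccAbove (fun _ : Fin 3 => ℝ) (Fin.last 2)).symm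
      ((volume : Measure ℝ).prod (volume : Measure (Fin 2 → ℝ))) (volume : Measure (Fin 3 → ℝ)) :=
    (volume_preserving_piFinSuccAbove (fun _ : Fin 3 => ℝ) (Fin.last 2)).symm
  have h3 : MeasurePreserving (WithLp.toLp 2 : (Fin 3 → ℝ) → EuclideanSpace ℝ (Fin 3)) volume volume :=
    PiLp.volume_preserving_toLp (Fin 3)
  have h4 : MeasurePreserving (R : EuclideanSpace ℝ (Fin 3) → EuclideanSpace ℝ (Fin 3)) volume volume :=
    R.measurePreserving
  have h := ((h4.comp h3).comp h2).comp h1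
  convert h using 1
  funext p
  obtain ⟨c, y⟩ := p
  simp only [Function.comp_apply, Prod.map_apply, id_eq, MeasurableEquiv.piFinSuccAbove_symm_apply]
  congr 2
  rw [← snoc_eq_vec3, ← Fin.insertNth_last']
  rfl

/-- **Fubini over the foliation.** For every Borel `g : ℝ³ → ℝ≥0∞` and every linear isometry `R`,
integrating `g` over the planes `R{x₂ = c}` (parametrised by `y ↦ R (y₀, y₁, c)`, area measure = Lebesgue
measure of `ℝ²`) and then over the height `c` gives the bulk integral: `∫⁻ c, ∫⁻ y, g (R (y₀,y₁,c)) = ∫⁻ g`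
(Tonelli along the measure-preserving chart `measurePreserving_foliationChart`). -/
theorem lintegral_lintegral_foliation : ∀ (R : EuclideanSpace ℝ (Fin 3) ≃ₗᵢ[ℝ] EuclideanSpace ℝ (Fin 3)) (g : EuclideanSpace ℝ (Fin 3) → ENNReal), Measurable g → ∫⁻ c : ℝ, ∫⁻ y : EuclideanSpace ℝ (Fin 2), g (R (WithLp.toLp 2 ![y 0, y 1, c])) = ∫⁻ x, g x := by
  intro R g hg
  have hT := measurePreserving_foliationChart R
  have hm : AEMeasurable (fun p : ℝ × EuclideanSpace ℝ (Fin 2) => g (R (WithLp.toLp 2 ![p.2 0, p.2 1, p.1])))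
      ((volume : Measure ℝ).prod (volume : Measure (EuclideanSpace ℝ (Fin 2)))) :=
    (hg.comp hT.measurable).aemeasurable
  calc ∫⁻ c : ℝ, ∫⁻ y : EuclideanSpace ℝ (Fin 2), g (R (WithLp.toLp 2 ![y 0, y 1, c]))
      = ∫⁻ p : ℝ × EuclideanSpace ℝ (Fin 2), g (R (WithLp.toLp 2 ![p.2 0, p.2 1, p.1]))
          ∂((volume : Measure ℝ).prod (volume : Measure (EuclideanSpace ℝ (Fin 2)))) :=
        (lintegral_prod _ hm).symm
    _ = ∫⁻ x, g x := hT.lintegral_comp hg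

/-- The same with the bulk integral on the left and an inequality-friendly `iSup` corollary: every
single plane integral of a Borel `g ≥ 0` is at most... no: planes have measure zero, so only the
height-INTEGRATED plane integrals are controlled by the bulk. Recorded form: for every measurable set of
heights `S`, `∫⁻ c in S, ∫⁻ y, g (R (y₀,y₁,c)) ≤ ∫⁻ g`. -/
theorem setLIntegral_lintegral_foliation_le
    (R : EuclideanSpace ℝ (Fin 3) ≃ₗᵢ[ℝ] EuclideanSpace ℝ (Fin 3)) {g : EuclideanSpace ℝ (Fin 3) → ℝ≥0∞}
    (hg : Measurable g) (S : Set ℝ) :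
    ∫⁻ c in S, ∫⁻ y : EuclideanSpace ℝ (Fin 2), g (R (WithLp.toLp 2 ![y 0, y 1, c])) ≤ ∫⁻ x, g x := by
  rw [← lintegral_lintegral_foliation R g hg]
  exact setLIntegral_le_lintegral S _

end Summit.NavierStokesRegularity.NavierStokesRegularity.Theorems.SlicedKelvinPlanarFluxAPriori

end
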